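import Summits.CriticalPhenomena.CardyFormulaZ2.Theorems.CardyFlipRussoQuadrupoleSelectionRuleAnnealedRusso
import Summits.CriticalPhenomena.CardyFormulaZ2.Theorems.CardyFlipRussoQuadrupoleSelectionRuleFlipLocalisation

/-!
# The annealed Russo INEQUALITY for a flip leg: the drift is bounded by the four-arm sum

Helper file for the crux `QuadrupoleSelectionRule` (stmt-CriticalPhenomena-7029, informal) of route
`CardyFlipRusso` (sub-problem `CardyFormulaZ2`), line `Sketch`.  Packaging of two landed files:
the annealed flip–Russo FORMULA for a product-of-bits environment
(`hasDerivWithinAt_annealed_flipLeg`, `…AnnealedRusso.lean`: the `t`-derivative of the annealed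
probability is `Σ_k E_t[Δ_k]`) and the four-arm LOCALISATION of the flip response
(`abs_flipResponse_le_real_sdiff_add`, `…FlipLocalisation.lean`: `|Δ_Q| ≤ P[created] + P[destroyed]`,
both four-arm-type events at `Q`).  Consequence (`abs_flipDrift_le_fourArm_sum`): the absolute
drift is at most the annealed sum over the faces of the probabilities of the two four-arm-type
events — the a-priori bound `≍ δ^{-2} · δ^{2 - 5/4} · δ^{…}` whose marginality the selection rule
must beat by CANCELLATION in the signed sum.
-/

noncomputable section

open MeasureTheory Set Filter

namespace Summit.CriticalPhenomena.CardyFormulaZ2.Theorems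

open Literature.Probability.LatticeModels Literature.Probability.Percolation AnnealedRusso

variable {κ V : Type*}

/-- A real function of `τ` reading only the bits in a finite set `K` is measurable (it is a
finite combination of cylinder indicators). [folklore] -/
theorem measurable_of_forall_eq_inter (K : Finset κ) (g : Set κ → ℝ)
    (hg : ∀ τ : Set κ, g τ = g (τ ∩ ↑K)) : Measurable g := by
  have hrepr : g = fun τ ↦ ∑ S ∈ K.powerset,
      (localCylinder (↑K : Set κ) ↑S).indicator (fun _ ↦ g ↑S) τ :=
    funext fun τ ↦ eq_sum_indicator_localCylinder K g hg τ
  rw [hrepr]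
  refine Finset.measurable_sum _ fun S _ ↦ ?_
  exact (measurable_const.indicator (measurableSet_localCylinder K.finite_toSet.countable _))

/-- A bounded function of finitely many bits is integrable under every `prodBernoulli q`.
[folklore] -/
theorem integrable_of_forall_eq_inter (K : Finset κ) (g : Set κ → ℝ)
    (hg : ∀ τ : Set κ, g τ = g (τ ∩ ↑K)) (M : ℝ) (hM : ∀ τ, |g τ| ≤ M) (q : κ → unitInterval) :
    Integrable g (prodBernoulli q) := by
  refine Integrable.of_bound (measurable_of_forall_eq_inter K g hg).aestronglyMeasurable M
    (Eventually.of_forall fun τ ↦ ?_)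
  simpa [Real.norm_eq_abs] using hM τ

/-- **Annealed Russo inequality for a flip leg.** In the setting of
`hasDerivWithinAt_annealed_flipLeg` (graphs `Γ τ` reading the bits in `K`; the events `U G'`
measurable), for every bit law `prodBernoulli q` the absolute annealed flip sum is bounded by the
annealed sum, over the faces `k ∈ K`, of the probabilities of what the flip at face `k` creates and
what it destroys — two four-arm-type events at the quadrilateral
(`crossing_flipGraph_sdiff_subset`, `crossing_sdiff_flipGraph_subset`). [folklore] -/
theorem abs_flipDrift_le_fourArm_sum [DecidableEq κ] (K : Finset κ) (Γ : Set κ → SimpleGraph V)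
    (hΓ : ∀ τ : Set κ, Γ τ = Γ (τ ∩ ↑K)) (A B C D : κ → V)
    (U : SimpleGraph V → Set (SiteConfig V)) (hU : ∀ G' : SimpleGraph V, MeasurableSet (U G'))
    (p : unitInterval) (q : κ → unitInterval) :
    |∑ k ∈ K, ∫ τ, flipResponse (Γ (τ \ {k})) (A k) (B k) (C k) (D k) U p ∂(prodBernoulli q)|
      ≤ ∑ k ∈ K, ∫ τ,
          ((sitePercolation V p).real
              (U (flipGraph (Γ (τ \ {k})) (A k) (B k) (C k) (D k)) \ U (Γ (τ \ {k}))) +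
            (sitePercolation V p).real
              (U (Γ (τ \ {k})) \ U (flipGraph (Γ (τ \ {k})) (A k) (B k) (C k) (D k))))
          ∂(prodBernoulli q) := by
  -- everything reads only the bits in `K`
  have hdet : ∀ k : κ, ∀ τ : Set κ, Γ (τ \ {k}) = Γ ((τ ∩ ↑K) \ {k}) := by
    intro k τ
    rw [hΓ (τ \ {k}), hΓ ((τ ∩ ↑K) \ {k})]
    congr 1
    ext i
    simp only [mem_inter_iff, Set.mem_sdiff, mem_singleton_iff, Finset.mem_coe]
    tauto
  refine (Finset.abs_sum_le_sum_abs _ _).trans (Finset.sum_le_sum fun k _ ↦ ?_)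
  set f : Set κ → ℝ := fun τ ↦ flipResponse (Γ (τ \ {k})) (A k) (B k) (C k) (D k) U p with hf
  set g : Set κ → ℝ := fun τ ↦
    (sitePercolation V p).real
        (U (flipGraph (Γ (τ \ {k})) (A k) (B k) (C k) (D k)) \ U (Γ (τ \ {k}))) +
      (sitePercolation V p).real
        (U (Γ (τ \ {k})) \ U (flipGraph (Γ (τ \ {k})) (A k) (B k) (C k) (D k))) with hgdef
  have hfK : ∀ τ, f τ = f (τ ∩ ↑K) := fun τ ↦ by simp only [hf, hdet k τ]
  have hgK : ∀ τ, g τ = g (τ ∩ ↑K) := fun τ ↦ by simp only [hgdef, hdet k τ]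
  have hfle : ∀ τ, |f τ| ≤ g τ := fun τ ↦
    abs_flipResponse_le_real_sdiff_add _ _ _ _ _ U p (hU _) (hU _)
  have hg1 : ∀ τ, |g τ| ≤ 2 := fun τ ↦ by
    have h0 : 0 ≤ g τ := le_trans (abs_nonneg _) (hfle τ)
    rw [abs_of_nonneg h0]
    have h1 : (sitePercolation V p).real
        (U (flipGraph (Γ (τ \ {k})) (A k) (B k) (C k) (D k)) \ U (Γ (τ \ {k}))) ≤ 1 :=
      measureReal_le_one
    have h2 : (sitePercolation V p).real
        (U (Γ (τ \ {k})) \ U (flipGraph (Γ (τ \ {k})) (A k) (B k) (C k) (D k))) ≤ 1 :=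
      measureReal_le_one
    simp only [hgdef]
    linarith
  have hfi : Integrable f (prodBernoulli q) :=
    integrable_of_forall_eq_inter K f hfK 1 (fun τ ↦ abs_flipResponse_le_one _ _ _ _ _ U p) q
  have hgi : Integrable g (prodBernoulli q) := integrable_of_forall_eq_inter K g hgK 2 hg1 q
  calc |∫ τ, f τ ∂(prodBernoulli q)| ≤ ∫ τ, |f τ| ∂(prodBernoulli q) := abs_integral_le_integral_abs
    _ ≤ ∫ τ, g τ ∂(prodBernoulli q) := integral_mono hfi.abs hgi hfle

end Summit.CriticalPhenomena.CardyFormulaZ2.Theorems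

end
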